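import Summits.NavierStokesRegularity.FluidComputer.PalasekTowerBurgersNumberStrain
import Summits.NavierStokesRegularity.FluidComputer.PalasekTowerHeredityWitnessCalibration

/-!
# REGISTER v2.3′: the Burgers number AT LEVEL 0 → 1, certified constants (planner ASK E8-a)

Evidence toward `stmt-NavierStokesRegularity-19250` (`HeredityFromTwo`) and its sister items 19249
(`HeredityAtOne`) / 19179 (`EpisodeBaseG`, the level-`0 → 1` episode): cell `ns-blowup`, seat
`ns-blowup-ecbridge-8` (g4), planner brief STATUS l.3303 (N-1) / l.3420 / l.3425 («instantiate the
polytope at `k = 0` BY NAME + λ_min exact»). LABEL: MODEL-side register arithmetic, the `k = 0`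
instance of `PalasekTowerBurgersNumber.lean` (p433323: `_thresholds_rigid`, `_band`) and
`PalasekTowerBurgersNumberStrain.lean` (p435415: `_strainFloor_axis`, `_strainFloor_missed`) with the
Burgers factor `N₀^{1/20} = 256^{1/20} = 2^{2/5}` and the DC1 margin `N₀^{1/10} = 2^{4/5}` replaced by
CERTIFIED two-sided rational brackets, so that every threshold is a decimal number the kernel has
checked. The numerics of record (`TowerRates.wide`: `N₀ = 256`, `b = 11/10`, `β = 23/10`;
`Schedule.Rigid`: `c₁ = 1`, `c₂ = 5/3`; `ν = 1`) come from ecbridge-6 g3's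
`PalasekTowerHeredityWitnessCalibration.lean` (`wide_A_zero_bounds`, `wide_A_one_bounds`,
`wide_N_one_rpow_bounds`, the dyadic bracketing lemmas `lt_two_rpow_of_pow_lt` /
`two_rpow_lt_of_pow_lt`).

WHAT THIS IS NOT: not NS — the Burgers vortex is an exact steady infinite-energy profile and no
registered stage; nothing is asserted about any registered flow, about `ReadoutFloors`,
`AprioriCeiling` or the truth of any crux. MODEL identification as in parts 1–2: «the level-1 child
core is the Burgers vortex of circulation `C · N₁^{β−2} = 6.233·C` equilibrated at `ν = 1` in the host
strain `λ · A₀`»; `P := C√λ · N₀^{1/20}` is its Burgers number.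

## §1 Certified level-0 constants

`1.3195 < N₀^{1/20} < 1.3196`, `1.7411 < N₀^{1/10} < 1.74111`, `3.58 < A₁/A₀ < 3.5802`
(`A₁/A₀ = 256^{23/100}`); with the calibration file's `6.233 < N₁^{β−2} < 6.234`.

## §2 The polytope at `k = 0` (velocity floor / ceiling read on the child's swirl, strain floor on `Du`)

* thresholds (`_thresholds_zero`): `C√λ ≤ 21.97` ⇒ no overshoot of `c₂Y₁` anywhere; `C√λ ≥ 25.77` ⇒
  overshoot somewhere; `C√λ ≥ 15.16` ⇒ the velocity floor `c₁Y₁` is met ON the core; `C√λ ≤ 12.88` ⇒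
  it is missed everywhere on the profile;
* the necessary band (`_band_zero`, sharp constants `4√2π ≤ P ≤ (500π/79)(5/3)`): velocity floor met
  on the core AND no overshoot ⇒ **`13.46 < C√λ < 25.12`** (the planner's `[14.93, 24.86]` is the same
  band at the NUMERICAL sharp peak factor `μ* = 0.638` of Saffman §13.1 (4), which is not certified:
  the kernel brackets the peak factor by `[0.632, 1/√2]`);
* strain floor (`_strainFloor_axis_zero`, `_strainFloor_missed_zero`): **`Cλ ≥ 14.44`** ⇒ the strain
  floor `c₁A₁` is met on the axis of the child (core rotation rate `(Cλ/8π)·N₀^{1/10}·A₁`, `8π/N₀^{1/10}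
  = 14.435`); `λ(1 + 0.745·C) ≤ 3.58` ⇒ it is missed EVERYWHERE on the full Burgers field
  (`‖D(U_s + v)‖ ≤ γ + 3|c|` of `BurgersVortexPeakSpeed`, `A₁/A₀ > 3.58`).

## §3 The λ-floors («λ_min») — what is certified and under which reading

* AXIS READING (`_lambda_floor_axis_zero`, the planner's N-1): if the child core does not overshoot
  `c₂Y₁` anywhere and ITS OWN gradient (the swirl's, `‖Dv(axis)‖ = |c|` exactly,
  `norm_fderiv_burgersVortexSwirl_axis`) meets the strain floor `c₁A₁` at an axis point, then
  **`Cλ > 14.43`, `C√λ < 25.12`, `λ > 0.33`, `C < 43.8`** (certified; the planner's HEUR `λ_min = 0.339`,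
  `C = 42.6` are the same numbers at `μ* = 0.638`). The exact operator norm of `D(U_s + v)` on the axis is
  `max(γ, (γ²/4 + c²)^{1/2})`, which moves the floor only in the fourth digit (`0.3297`).
* FULL-FIELD READING (`_lambda_floor_zero`): if the floor is only asked SOMEWHERE on the full field
  `U_s + v`, the kernel's everywhere-bound `γ + 3|c|` certifies only `λ(1 + 0.745C) > 3.58`, hence
  **`λ > 0.035`** with the ceiling — the factor `3` (sharp: `1`, giving `0.28`) is the loose link, recorded
  here as the honest gap between the two readings.

References: P. G. Saffman, *Vortex Dynamics*, CUP 1992, §13.1 (4), §13.3 (9), (12)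
[cite: Saffman1992, §13.3 eq. (12)]; S. Palasek, arXiv:2605.13827, §3 (3.2)
[cite: Palasek2026ElementaryModel, §3 (3.2)].
-/

namespace Summit.NavierStokesRegularity.FluidComputer.PalasekTowerClayBridge

open Real
open Literature.Analysis.FluidPDE

/-! ## §1 Certified level-0 constants of the wide register -/

/-- `N₀^q = 2^{8q}` on the wide rates (`N₀ = 256 = 2⁸`). -/
theorem wide_N_zero_rpow_eq (q : ℝ) : TowerRates.wide.N 0 ^ q = (2 : ℝ) ^ (8 * q) := by
  rw [TowerRates.wide_N_zero, show (256 : ℝ) = (2 : ℝ) ^ (8 : ℝ) by norm_num,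
    ← Real.rpow_mul (by norm_num)]

/-- **The level-0 Burgers factor** `N₀^{1/20} = 2^{2/5} ∈ (1.3195, 1.3196)`
(`1.3195⁵ < 4 < 1.3196⁵`). -/
theorem wide_burgersFactor_zero_bounds :
    1.3195 < TowerRates.wide.N 0 ^ (1 / 20 : ℝ) ∧ TowerRates.wide.N 0 ^ (1 / 20 : ℝ) < 1.3196 := by
  rw [wide_N_zero_rpow_eq, show (8 : ℝ) * (1 / 20) = 2 / 5 by norm_num]
  exact ⟨TowerRates.lt_two_rpow_of_pow_lt (a := 2) (m := 1) (r := 5) (by norm_num) (by norm_num),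
    TowerRates.two_rpow_lt_of_pow_lt (by norm_num) (a := 2) (m := 1) (r := 5) (by norm_num)
      (by norm_num)⟩

/-- **The level-0 DC1 margin** `N₀^{1/10} = 2^{4/5} ∈ (1.7411, 1.74111)`
(`1.7411⁵ < 16 < 1.74111⁵`). -/
theorem wide_dc1Margin_zero_bounds :
    1.7411 < TowerRates.wide.N 0 ^ (1 / 10 : ℝ) ∧ TowerRates.wide.N 0 ^ (1 / 10 : ℝ) < 1.74111 := by
  rw [wide_N_zero_rpow_eq, show (8 : ℝ) * (1 / 10) = 4 / 5 by norm_num]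
  exact ⟨TowerRates.lt_two_rpow_of_pow_lt (a := 4) (m := 1) (r := 5) (by norm_num) (by norm_num),
    TowerRates.two_rpow_lt_of_pow_lt (by norm_num) (a := 4) (m := 1) (r := 5) (by norm_num)
      (by norm_num)⟩

/-- **The amplitude jump** `A₁/A₀ = 256^{23/100} ∈ (3.58, 3.5802)` (from the certified integer brackets
`345901 < A₀ < 345902`, `1238360 < A₁ < 1238361`). -/
theorem wide_A_one_div_A_zero_bounds :
    3.58 * TowerRates.wide.A 0 < TowerRates.wide.A 1 ∧
      TowerRates.wide.A 1 < 3.5802 * TowerRates.wide.A 0 := by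
  obtain ⟨h0, h0'⟩ := TowerRates.wide_A_zero_bounds
  obtain ⟨h1, h1'⟩ := TowerRates.wide_A_one_bounds
  constructor <;> linarith

/-! ## §2 The polytope at level `0 → 1`

The MODEL object: `burgersVortexSwirl (λ * A₀) 1 (C * N₁^{β−2})` (swirl) and
`burgersVortex (λ * A₀) 1 (C * N₁^{β−2}) = U_s + v` (full field) — the level-1 child core of
circulation `C · N₁^{β−2}` at `ν = 1` in the host strain `λ · A₀`; `P = C√λ · N₀^{1/20}`. -/

/-- Upper transfer: `C√λ ≤ M` and `M · 1.3196 ≤ B` give `P ≤ B`. -/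
private theorem burgersNumber_zero_le {C l M B : ℝ} (hC : 0 ≤ C) (h : C * Real.sqrt l ≤ M)
    (hB : M * 1.3196 ≤ B) : C * Real.sqrt l * TowerRates.wide.N 0 ^ (1 / 20 : ℝ) ≤ B := by
  obtain ⟨-, hf⟩ := wide_burgersFactor_zero_bounds
  have hP : 0 ≤ C * Real.sqrt l := mul_nonneg hC (Real.sqrt_nonneg _)
  have hf0 : 0 ≤ TowerRates.wide.N 0 ^ (1 / 20 : ℝ) := Real.rpow_nonneg (TowerRates.wide.N_pos 0).le _
  nlinarith [mul_le_mul h hf.le hf0 (hP.trans h)]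

/-- Lower transfer: `M ≤ C√λ`, `0 ≤ M` and `B ≤ M · 1.3195` give `B ≤ P`. -/
private theorem le_burgersNumber_zero {C l M B : ℝ} (h : M ≤ C * Real.sqrt l) (hM : 0 ≤ M)
    (hB : B ≤ M * 1.3195) : B ≤ C * Real.sqrt l * TowerRates.wide.N 0 ^ (1 / 20 : ℝ) := by
  obtain ⟨hf, -⟩ := wide_burgersFactor_zero_bounds
  nlinarith [mul_le_mul h hf.le (by norm_num) (hM.trans h)]

/-- **Certified thresholds at level `0 → 1`** (wide rates, `Schedule.Rigid`): `C√λ ≤ 21.97` ⇒ no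
overshoot of `S.c₂ · Y₁` anywhere on the child core; `C√λ ≥ 25.77` ⇒ overshoot somewhere;
`C√λ ≥ 15.16` ⇒ the velocity floor `S.c₁ · Y₁` is met ON the core; `C√λ ≤ 12.88` ⇒ it is missed
everywhere on the profile (`29/1.3196`, `34/1.3195`, `20/1.3195`, `17/1.3196` of `_thresholds_rigid`). -/
theorem palasekTowerBreakdown_burgers_thresholds_zero (S : Schedule TowerRates.wide) (hS : S.Rigid)
    {C l : ℝ} (hC : 0 ≤ C) (hl : 0 < l) :
    (C * Real.sqrt l ≤ 21.97 → ∀ x : EuclideanSpace ℝ (Fin 3),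
      ‖burgersVortexSwirl (l * TowerRates.wide.A 0) 1
          (C * TowerRates.wide.N 1 ^ (TowerRates.wide.β - 2)) x‖ ≤ S.c₂ * TowerRates.wide.Y 1) ∧
    (25.77 ≤ C * Real.sqrt l → ∃ x : EuclideanSpace ℝ (Fin 3),
      S.c₂ * TowerRates.wide.Y 1 < ‖burgersVortexSwirl (l * TowerRates.wide.A 0) 1
          (C * TowerRates.wide.N 1 ^ (TowerRates.wide.β - 2)) x‖) ∧
    (15.16 ≤ C * Real.sqrt l → ∃ x : EuclideanSpace ℝ (Fin 3),
      S.c₁ * TowerRates.wide.Y 1 ≤ ‖burgersVortexSwirl (l * TowerRates.wide.A 0) 1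
          (C * TowerRates.wide.N 1 ^ (TowerRates.wide.β - 2)) x‖) ∧
    (C * Real.sqrt l ≤ 12.88 → ∀ x : EuclideanSpace ℝ (Fin 3),
      ‖burgersVortexSwirl (l * TowerRates.wide.A 0) 1
          (C * TowerRates.wide.N 1 ^ (TowerRates.wide.β - 2)) x‖ < S.c₁ * TowerRates.wide.Y 1) := by
  obtain ⟨h29, h34, h20, h17⟩ := palasekTowerBreakdown_burgers_thresholds_rigid S hS 0 hC hl
  refine ⟨fun h => h29 ?_, fun h => h34 ?_, fun h => h20 ?_, fun h => h17 ?_⟩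
  · exact burgersNumber_zero_le hC h (by norm_num)
  · exact le_burgersNumber_zero h (by norm_num) (by norm_num)
  · exact le_burgersNumber_zero h (by norm_num) (by norm_num)
  · exact burgersNumber_zero_le hC h (by norm_num)

/-- `17.7713 < 4√2π` and `(500π/79)·(5/3) < 33.1392`, `25.13273 < 8π < 25.13275`. -/
private theorem burgers_constants_zero :
    (17.7713 : ℝ) < 4 * Real.sqrt 2 * π ∧ 500 * π / 79 * (5 / 3 : ℝ) < 33.1392 ∧
      (25.13273 : ℝ) < 8 * π ∧ 8 * π < (25.13275 : ℝ) := by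
  have hpi1 := Real.pi_gt_d6
  have hpi2 := Real.pi_lt_d6
  have hs : (1.41421 : ℝ) < Real.sqrt 2 := by
    rw [Real.lt_sqrt (by norm_num)]; norm_num
  refine ⟨by nlinarith, by nlinarith, by linarith, by linarith⟩

/-- **The necessary band at level `0 → 1`, certified**: if the Burgers child core meets the velocity
floor `S.c₁ · Y₁` somewhere by its own swirl AND does not overshoot the ceiling `S.c₂ · Y₁` anywhere,
then `13.46 < C√λ < 25.12` (sharp constants `4√2π ≤ P ≤ (500π/79)·(5/3)` of `_burgers_band`, divided
by the bracket of `N₀^{1/20}`). -/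
theorem palasekTowerBreakdown_burgers_band_zero (S : Schedule TowerRates.wide) (hS : S.Rigid)
    {C l : ℝ} (hC : 0 ≤ C) (hl : 0 < l)
    (hfloor : ∃ x : EuclideanSpace ℝ (Fin 3), S.c₁ * TowerRates.wide.Y 1 ≤
      ‖burgersVortexSwirl (l * TowerRates.wide.A 0) 1
          (C * TowerRates.wide.N 1 ^ (TowerRates.wide.β - 2)) x‖)
    (hceil : ∀ x : EuclideanSpace ℝ (Fin 3),
      ‖burgersVortexSwirl (l * TowerRates.wide.A 0) 1
          (C * TowerRates.wide.N 1 ^ (TowerRates.wide.β - 2)) x‖ ≤ S.c₂ * TowerRates.wide.Y 1) :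
    13.46 < C * Real.sqrt l ∧ C * Real.sqrt l < 25.12 := by
  obtain ⟨h1, h2⟩ := palasekTowerBreakdown_burgers_band TowerRates.wide 0 hC hl hfloor hceil
  rw [palasekTowerBreakdown_burgers_exponent_wide, hS.c₁_eq] at h1
  rw [palasekTowerBreakdown_burgers_exponent_wide, hS.c₂_eq] at h2
  obtain ⟨c17, c33, -, -⟩ := burgers_constants_zero
  obtain ⟨hf, hf'⟩ := wide_burgersFactor_zero_bounds
  have hP : 0 ≤ C * Real.sqrt l := mul_nonneg hC (Real.sqrt_nonneg _)
  constructor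
  · by_contra h
    push Not at h
    have := mul_le_mul h hf'.le (Real.rpow_nonneg (TowerRates.wide.N_pos 0).le _) (by norm_num)
    nlinarith
  · by_contra h
    push Not at h
    have := mul_le_mul h hf.le (by norm_num) hP
    nlinarith

/-- **The strain floor at level `0 → 1` is met ON THE AXIS of the child core as soon as `Cλ ≥ 14.44`**
(`8π · S.c₁ ≤ Cλ · N₀^{1/10}` of `_strainFloor_axis`; `8π/N₀^{1/10} = 14.435`): then
`S.c₁ · A₁ ≤ ‖D(U_s + v)(x)‖` at some `x`. -/
theorem palasekTowerBreakdown_burgers_strainFloor_axis_zero (S : Schedule TowerRates.wide)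
    (hS : S.Rigid) {C l : ℝ} (hC : 0 ≤ C) (hl : 0 < l) (hP : 14.44 ≤ C * l) :
    ∃ x : EuclideanSpace ℝ (Fin 3), S.c₁ * TowerRates.wide.A 1 ≤
      ‖fderiv ℝ (burgersVortex (l * TowerRates.wide.A 0) 1
        (C * TowerRates.wide.N 1 ^ (TowerRates.wide.β - 2))) x‖ := by
  refine palasekTowerBreakdown_burgers_strainFloor_axis TowerRates.wide 0 hC hl ?_
  rw [palasekTowerBreakdown_burgers_strainExponent_wide, hS.c₁_eq]
  obtain ⟨-, -, -, c8⟩ := burgers_constants_zero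
  obtain ⟨hg, -⟩ := wide_dc1Margin_zero_bounds
  have hCl : 0 ≤ C * l := mul_nonneg hC hl.le
  nlinarith [mul_le_mul hP hg.le (by norm_num) hCl]

/-- **The strain floor at level `0 → 1` is missed EVERYWHERE on the full Burgers field when
`λ(1 + 0.745·C) ≤ 3.58`** (`λA₀(1 + 3·C N₁^{β−2}/(8π)) < S.c₁ A₁` of `_strainFloor_missed`, with
`3 · 6.234/(8π) < 0.745` and `3.58 · A₀ < A₁`). -/
theorem palasekTowerBreakdown_burgers_strainFloor_missed_zero (S : Schedule TowerRates.wide)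
    (hS : S.Rigid) {C l : ℝ} (hC : 0 ≤ C) (hl : 0 < l) (hP : l * (1 + 0.745 * C) ≤ 3.58)
    (x : EuclideanSpace ℝ (Fin 3)) :
    ‖fderiv ℝ (burgersVortex (l * TowerRates.wide.A 0) 1
        (C * TowerRates.wide.N 1 ^ (TowerRates.wide.β - 2))) x‖ < S.c₁ * TowerRates.wide.A 1 := by
  refine palasekTowerBreakdown_burgers_strainFloor_missed TowerRates.wide 0 hC hl ?_ x
  rw [hS.c₁_eq, one_mul]
  obtain ⟨-, -, c8, -⟩ := burgers_constants_zero
  obtain ⟨-, hN⟩ := TowerRates.wide_N_one_rpow_bounds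
  obtain ⟨hA, -⟩ := wide_A_one_div_A_zero_bounds
  have hA0 : 0 < TowerRates.wide.A 0 := TowerRates.wide.A_pos 0
  have hN0 : 0 ≤ TowerRates.wide.N 1 ^ (TowerRates.wide.β - 2) :=
    Real.rpow_nonneg (TowerRates.wide.N_pos 1).le _
  -- `3 C N₁^{β−2}/(8π) ≤ 0.745 C`
  have hq : 3 * (C * TowerRates.wide.N 1 ^ (TowerRates.wide.β - 2)) / (8 * π) ≤ 0.745 * C := by
    rw [div_le_iff₀ (by positivity)]
    nlinarith [mul_le_mul_of_nonneg_left hN.le hC]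
  calc l * TowerRates.wide.A 0 * (1 + 3 * (C * TowerRates.wide.N 1 ^ (TowerRates.wide.β - 2)) / (8 * π))
      ≤ l * TowerRates.wide.A 0 * (1 + 0.745 * C) := by
        refine mul_le_mul_of_nonneg_left (by linarith) (by positivity)
    _ = l * (1 + 0.745 * C) * TowerRates.wide.A 0 := by ring
    _ ≤ 3.58 * TowerRates.wide.A 0 := mul_le_mul_of_nonneg_right hP hA0.le
    _ < TowerRates.wide.A 1 := hA

/-! ## §3 The λ-floors -/

/-- **No overshoot caps the Burgers number**: if the child core stays under `S.c₂ · Y₁` everywhere,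
then `C√λ < 25.116` (contrapositive of `_burgers_overshoot` at `k = 0`). -/
theorem palasekTowerBreakdown_burgers_ceiling_cap_zero (S : Schedule TowerRates.wide) (hS : S.Rigid)
    {C l : ℝ} (hC : 0 ≤ C) (hl : 0 < l)
    (hceil : ∀ x : EuclideanSpace ℝ (Fin 3),
      ‖burgersVortexSwirl (l * TowerRates.wide.A 0) 1
          (C * TowerRates.wide.N 1 ^ (TowerRates.wide.β - 2)) x‖ ≤ S.c₂ * TowerRates.wide.Y 1) :
    C * Real.sqrt l < 25.116 := by
  have h2 : C * Real.sqrt l * TowerRates.wide.N 0 ^ (TowerRates.wide.β / 2 - TowerRates.wide.b) ≤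
      500 * π / 79 * S.c₂ := by
    by_contra h
    push Not at h
    obtain ⟨x, hx⟩ := palasekTowerBreakdown_burgers_overshoot TowerRates.wide 0 hC hl h
    exact absurd (hceil x) (not_le.2 hx)
  rw [palasekTowerBreakdown_burgers_exponent_wide, hS.c₂_eq] at h2
  obtain ⟨-, c33, -, -⟩ := burgers_constants_zero
  obtain ⟨hf, -⟩ := wide_burgersFactor_zero_bounds
  have hP : 0 ≤ C * Real.sqrt l := mul_nonneg hC (Real.sqrt_nonneg _)
  by_contra h
  push Not at h
  have := mul_le_mul h hf.le (by norm_num) hP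
  nlinarith

/-- **The strain floor read on the child's own gradient at the axis pins `Cλ`**: if at an axis point
`x₀` the swirl gradient (`‖Dv(x₀)‖ = |γΓ/(8πν)|` exactly, `norm_fderiv_burgersVortexSwirl_axis`) meets
`S.c₁ · A₁`, then `Cλ > 14.434` (`8π/N₀^{1/10}`). -/
theorem palasekTowerBreakdown_burgers_axisFloor_pins_zero (S : Schedule TowerRates.wide)
    (hS : S.Rigid) {C l : ℝ} (hC : 0 ≤ C) (hl : 0 < l) {x₀ : EuclideanSpace ℝ (Fin 3)}
    (hx0 : x₀ 0 = 0) (hx1 : x₀ 1 = 0)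
    (haxis : S.c₁ * TowerRates.wide.A 1 ≤
      ‖fderiv ℝ (burgersVortexSwirl (l * TowerRates.wide.A 0) 1
        (C * TowerRates.wide.N 1 ^ (TowerRates.wide.β - 2))) x₀‖) :
    14.434 < C * l := by
  rw [norm_fderiv_burgersVortexSwirl_axis _ _ _ hx0 hx1,
    palasekTowerBreakdown_burgers_coreRate TowerRates.wide 0 hC hl,
    palasekTowerBreakdown_burgers_strainExponent_wide, hS.c₁_eq, one_mul] at haxis
  have hA1 : 0 < TowerRates.wide.A 1 := TowerRates.wide.A_pos 1
  have h1 : 1 ≤ C * l / (8 * π) * TowerRates.wide.N 0 ^ (1 / 10 : ℝ) := by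
    by_contra h
    push Not at h
    have := mul_lt_mul_of_pos_right h hA1
    linarith
  obtain ⟨-, -, c8, -⟩ := burgers_constants_zero
  obtain ⟨-, hg⟩ := wide_dc1Margin_zero_bounds
  have hpi : 0 < 8 * π := by positivity
  rw [div_mul_eq_mul_div, le_div_iff₀ hpi, one_mul] at h1
  have hCl : 0 ≤ C * l := mul_nonneg hC hl.le
  by_contra h
  push Not at h
  have := mul_le_mul h hg.le (Real.rpow_nonneg (TowerRates.wide.N_pos 0).le _) (by norm_num)
  nlinarith

/-- **λ-floor, AXIS READING (the planner's N-1, certified)**: if the level-1 Burgers child core does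
not overshoot `S.c₂ · Y₁` anywhere and its own gradient meets the strain floor `S.c₁ · A₁` at an axis
point, then `14.43 < Cλ`, `C√λ < 25.12`, **`0.33 < λ`** and `C < 43.8` (`√λ = Cλ/(C√λ) > 14.434/25.116`;
HEUR sharp values `λ_min = 0.339`, `C = 42.6` at `μ* = 0.638` are not certified). -/
theorem palasekTowerBreakdown_burgers_lambda_floor_axis_zero (S : Schedule TowerRates.wide)
    (hS : S.Rigid) {C l : ℝ} (hC : 0 ≤ C) (hl : 0 < l)
    (hceil : ∀ x : EuclideanSpace ℝ (Fin 3),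
      ‖burgersVortexSwirl (l * TowerRates.wide.A 0) 1
          (C * TowerRates.wide.N 1 ^ (TowerRates.wide.β - 2)) x‖ ≤ S.c₂ * TowerRates.wide.Y 1)
    {x₀ : EuclideanSpace ℝ (Fin 3)} (hx0 : x₀ 0 = 0) (hx1 : x₀ 1 = 0)
    (haxis : S.c₁ * TowerRates.wide.A 1 ≤
      ‖fderiv ℝ (burgersVortexSwirl (l * TowerRates.wide.A 0) 1
        (C * TowerRates.wide.N 1 ^ (TowerRates.wide.β - 2))) x₀‖) :
    14.43 < C * l ∧ C * Real.sqrt l < 25.12 ∧ 0.33 < l ∧ C < 43.8 := by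
  have hcap := palasekTowerBreakdown_burgers_ceiling_cap_zero S hS hC hl hceil
  have hpin := palasekTowerBreakdown_burgers_axisFloor_pins_zero S hS hC hl hx0 hx1 haxis
  have hs : 0 ≤ Real.sqrt l := Real.sqrt_nonneg _
  have hsq : Real.sqrt l ^ 2 = l := Real.sq_sqrt hl.le
  have hP : 0 ≤ C * Real.sqrt l := mul_nonneg hC hs
  -- `C l = √l · (C √l)`
  have hid : C * l = Real.sqrt l * (C * Real.sqrt l) := by
    rw [show C * l = C * (Real.sqrt l ^ 2) by rw [hsq]]; ring
  have hCpos : 0 < C := by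
    rcases hC.eq_or_lt with h | h
    · rw [← h, zero_mul] at hpin; linarith
    · exact h
  refine ⟨by linarith, by linarith, ?_, ?_⟩
  · -- `√l > 14.434 / 25.116 > 0.5746`, so `l > 0.33`
    have h1 : 0.5746 < Real.sqrt l := by
      by_contra h
      push Not at h
      have := mul_le_mul h hcap.le hP (by norm_num)
      nlinarith
    nlinarith
  · -- `C · (C l) = (C √l)² < 25.116²`, `C l > 14.434`
    have h2 : C * (C * l) = (C * Real.sqrt l) ^ 2 := by
      rw [mul_pow, hsq]; ring
    have h3 : (C * Real.sqrt l) ^ 2 < 25.116 ^ 2 := by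
      exact pow_lt_pow_left₀ hcap hP two_ne_zero
    nlinarith

/-- **λ-floor, FULL-FIELD READING (honest necessary form)**: if the child core does not overshoot
`S.c₂ · Y₁` anywhere and the strain floor `S.c₁ · A₁` is met SOMEWHERE on the full field `U_s + v`,
the kernel's everywhere-bound `‖D(U_s + v)‖ ≤ γ + 3|c|` certifies `3.58 < λ(1 + 0.745·C)` and hence
only `0.035 < λ` (`Cλ < 25.116√λ`; the factor `3` is the loose link — sharp `1` would give `0.28`, the
axis operator norm `0.33`). -/
theorem palasekTowerBreakdown_burgers_lambda_floor_zero (S : Schedule TowerRates.wide) (hS : S.Rigid)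
    {C l : ℝ} (hC : 0 ≤ C) (hl : 0 < l)
    (hceil : ∀ x : EuclideanSpace ℝ (Fin 3),
      ‖burgersVortexSwirl (l * TowerRates.wide.A 0) 1
          (C * TowerRates.wide.N 1 ^ (TowerRates.wide.β - 2)) x‖ ≤ S.c₂ * TowerRates.wide.Y 1)
    (hstrain : ∃ x : EuclideanSpace ℝ (Fin 3), S.c₁ * TowerRates.wide.A 1 ≤
      ‖fderiv ℝ (burgersVortex (l * TowerRates.wide.A 0) 1
        (C * TowerRates.wide.N 1 ^ (TowerRates.wide.β - 2))) x‖) :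
    3.58 < l * (1 + 0.745 * C) ∧ 0.035 < l := by
  have hcap := palasekTowerBreakdown_burgers_ceiling_cap_zero S hS hC hl hceil
  have h1 : 3.58 < l * (1 + 0.745 * C) := by
    by_contra h
    push Not at h
    obtain ⟨x, hx⟩ := hstrain
    exact absurd hx (not_le.2
      (palasekTowerBreakdown_burgers_strainFloor_missed_zero S hS hC hl h x))
  refine ⟨h1, ?_⟩
  have hs : 0 ≤ Real.sqrt l := Real.sqrt_nonneg _
  have hsq : Real.sqrt l ^ 2 = l := Real.sq_sqrt hl.le
  have hP : 0 ≤ C * Real.sqrt l := mul_nonneg hC hs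
  -- `l · C = √l · (C√l) ≤ 25.116 √l`
  have h2 : l * C ≤ 25.116 * Real.sqrt l := by
    rw [show l * C = Real.sqrt l * (C * Real.sqrt l) by
      rw [show l * C = Real.sqrt l ^ 2 * C by rw [hsq]]; ring]
    nlinarith [mul_le_mul_of_nonneg_left hcap.le hs]
  by_contra h
  push Not at h
  -- `√l ≤ 0.18709`
  have h3 : Real.sqrt l ≤ 0.18709 := by
    rw [Real.sqrt_le_left (by norm_num)]
    linarith
  nlinarith

/-- **THE LEVEL-`0 → 1` BURGERS POLYTOPE, certified** (planner ASK E8-a, N-1 of STATUS l.3303 by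
name): a level-1 Burgers child core of circulation `C · N₁^{β−2}` in the host strain `λ · A₀` at `ν = 1`
that (i) meets the velocity floor `S.c₁ · Y₁` by its own swirl, (ii) does not overshoot `S.c₂ · Y₁`
anywhere, and (iii) meets the strain floor `S.c₁ · A₁` by its own gradient at an axis point, has
`13.46 < C√λ < 25.12`, `14.43 < Cλ`, `0.33 < λ` and `C < 43.8`. -/
theorem palasekTowerBreakdown_burgers_polytope_zero (S : Schedule TowerRates.wide) (hS : S.Rigid)
    {C l : ℝ} (hC : 0 ≤ C) (hl : 0 < l)
    (hfloor : ∃ x : EuclideanSpace ℝ (Fin 3), S.c₁ * TowerRates.wide.Y 1 ≤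
      ‖burgersVortexSwirl (l * TowerRates.wide.A 0) 1
          (C * TowerRates.wide.N 1 ^ (TowerRates.wide.β - 2)) x‖)
    (hceil : ∀ x : EuclideanSpace ℝ (Fin 3),
      ‖burgersVortexSwirl (l * TowerRates.wide.A 0) 1
          (C * TowerRates.wide.N 1 ^ (TowerRates.wide.β - 2)) x‖ ≤ S.c₂ * TowerRates.wide.Y 1)
    {x₀ : EuclideanSpace ℝ (Fin 3)} (hx0 : x₀ 0 = 0) (hx1 : x₀ 1 = 0)
    (haxis : S.c₁ * TowerRates.wide.A 1 ≤
      ‖fderiv ℝ (burgersVortexSwirl (l * TowerRates.wide.A 0) 1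
        (C * TowerRates.wide.N 1 ^ (TowerRates.wide.β - 2))) x₀‖) :
    (13.46 < C * Real.sqrt l ∧ C * Real.sqrt l < 25.12) ∧ 14.43 < C * l ∧ 0.33 < l ∧ C < 43.8 := by
  obtain ⟨h1, h2, h3, h4⟩ :=
    palasekTowerBreakdown_burgers_lambda_floor_axis_zero S hS hC hl hceil hx0 hx1 haxis
  exact ⟨palasekTowerBreakdown_burgers_band_zero S hS hC hl hfloor hceil, h1, h3, h4⟩

end Summit.NavierStokesRegularity.FluidComputer.PalasekTowerClayBridge
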